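import Summits.HodgeConjecture.HodgeCM.PerL34.ArchCOrbitDilation_1

/-! PORT of `HodgeCM/PerL34/ArchCOrbitDilation.lean` (HodgeCMPerL run 82) — part 2: continuation of `Summits.HodgeConjecture.HodgeCM.PerL34.ArchCOrbitDilation_1` (split at a top-level declaration boundary by port_pkg.py; scope re-opened below; declarations unchanged). -/

-- port_pkg: scope re-opened for this part (file-level context, then the namespace/section stack open at the cut)
noncomputable section
open MeasureTheory SchwartzMap HodgeCM.PerL34.LocalFactors.DilationModel
open scoped ENNReal Pointwise NNReal Topology
namespace HodgeCM.PerL34.ArchC.DilationToy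
/-- door [D5‴] at `t₀ = 0` for the unitary group: `HasDerivAt (t ↦ U t Φ) (gen Φ) 0` in `L²(ℝ)` -/
theorem hasDerivAt_U_zero (Φ : 𝓢(ℝ, ℂ)) :
    HasDerivAt (fun t : ℝ => (U t (Φ.toLp 2 (volume : Measure ℝ)) : Lp ℂ 2 (volume : Measure ℝ)))
      ((gen Φ).toLp 2 volume) 0 := by
  have hfun : (fun t : ℝ => (U t (Φ.toLp 2 (volume : Measure ℝ)) : Lp ℂ 2 (volume : Measure ℝ)))
      = fun t => (dil t Φ).toLp 2 volume := funext fun t => toLp_dil t Φ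
  rw [hfun]; exact hasDerivAt_toLp_dil_zero Φ

/-- door [D5‴] at every `t₀`: `HasDerivAt (t ↦ U t Φ) (U t₀ (gen Φ)) t₀` — literally the shape of
`FockThetaBridge.thetaC1` (with `R = U`, `Θ = Φ`, `X·Θ = gen Φ`), by the group law and the continuity of the
unitary `U t₀` -/
theorem hasDerivAt_U (Φ : 𝓢(ℝ, ℂ)) (t₀ : ℝ) :
    HasDerivAt (fun t : ℝ => (U t (Φ.toLp 2 (volume : Measure ℝ)) : Lp ℂ 2 (volume : Measure ℝ)))
      (U t₀ ((gen Φ).toLp 2 volume)) t₀ := by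
  -- `U t Φ = U t₀ (U (t − t₀) Φ)`
  have hfun : (fun t : ℝ => (U t (Φ.toLp 2 (volume : Measure ℝ)) : Lp ℂ 2 (volume : Measure ℝ)))
      = fun t => U t₀ (U (t - t₀) (Φ.toLp 2 volume)) := by
    funext t; rw [← U_add_apply, show t₀ + (t - t₀) = t by ring]
  rw [hfun]
  -- the inner curve has derivative `gen Φ` at `t₀`
  have hin : HasDerivAt (fun t : ℝ => (U (t - t₀) (Φ.toLp 2 (volume : Measure ℝ)) : Lp ℂ 2 volume))
      ((gen Φ).toLp 2 volume) t₀ :=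
    HasDerivAt.comp_sub_const
      (f := fun s : ℝ => (U s (Φ.toLp 2 (volume : Measure ℝ)) : Lp ℂ 2 (volume : Measure ℝ))) t₀ t₀
      (by rw [sub_self]; exact hasDerivAt_U_zero Φ)
  -- compose with the continuous linear `U t₀`
  have hL : HasDerivAt (fun t : ℝ => U t₀ (U (t - t₀) (Φ.toLp 2 (volume : Measure ℝ))))
      (U t₀ ((gen Φ).toLp 2 volume)) t₀ :=
    ((U t₀).toContinuousLinearEquiv.toContinuousLinearMap.restrictScalars ℝ).hasFDerivAt.comp_hasDerivAt
      t₀ hin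
  exact hL

/-- the derivative in the Schwartz picture at every `t₀`: `U t₀ (gen Φ) = dil t₀ (gen Φ)` -/
theorem hasDerivAt_U' (Φ : 𝓢(ℝ, ℂ)) (t₀ : ℝ) :
    HasDerivAt (fun t : ℝ => (U t (Φ.toLp 2 (volume : Measure ℝ)) : Lp ℂ 2 (volume : Measure ℝ)))
      ((dil t₀ (gen Φ)).toLp 2 volume) t₀ := by
  rw [← toLp_dil]; exact hasDerivAt_U Φ t₀

end HodgeCM.PerL34.ArchC.DilationToy

end
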